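import Literature.Analysis.FluidPDE.Ferrari1993Continuation
import HarnessLib

/-!
# The Green-matrix predicate for the div–curl system with the tangential boundary condition
in the periodic cylinder

Topic `Literature/Analysis/FluidPDE`. **Hypothesis-form infrastructure: one `Prop`-valued
structure and its unfolding API, everything proved, no named fact.**

The printed proofs of the logarithmic `W^{1,∞}` estimate for the div–curl system in a bounded
domain — Ferrari 1993, Prop. 1 (30) p. 286 through the global `δ`-estimate (71) p. 292, and
Shirota–Yanagisawa 1993, (15) p. 80 through (21) p. 81; in this tree the named fact
`ShirotaYanagisawa1993_periodicCylinderLogDivCurlEstimate` (`Ferrari1993LogEstimateReduction.lean`),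
to which the renderings of (71), of Prop. 1 and of the `δ`-families are proved equivalent or
stronger (`Ferrari1993Prop1DeltaFamily.lean`, `PeriodicCylinderLogDivCurl.lean`) — import from
the theory of elliptic boundary value problems the **integral
representation of a vector field tangential on the boundary through its curl and its
divergence, with a kernel obeying Calderón–Zygmund-type bounds up to the boundary**:

* Ferrari 1993, Thm 4 p. 285 ("a specialization of Theorem 1.1 of [11]" = Solonnikov 1970): for
  the first-order system (21) = (22) pp. 283–284 (`𝓛v = φ` in `Ω`, `𝓑v = χ` on `∂Ω` for
  `v = (u, φ)`: `curl u + ∇φ` and `div u` inside, `u·n` and `φ` on the boundary), uniformly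
  elliptic with complementing boundary condition in the sense of Agmon–Douglis–Nirenberg
  (Lemma 3 p. 284), the unique solution with `χ = 0` is `u(x) = ∫_Ω 𝒢(x, y) f(y) dy` (28) with
  `|D^β 𝒢(x, y)| ≤ C|x − y|^{-2-|β|}` for all `x, y ∈ Ω̄` and every `β` (29), used as (33)–(34)
  p. 286; a velocity field `u` tangential on `∂Ω` gives the solution `v = (u, 0)` with interior
  datum `(curl u, div u)` and boundary datum `χ = 0` (Proof of Corollary 1 p. 286, where
  `div u = 0`);
* Shirota–Yanagisawa 1993, decomposition theorem (5) and generalized Biot–Savart law (6) p. 78: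
  on a bounded domain of general topology `u = Σᵢ (u, aᵢ) aᵢ + δ Â⁻¹ d u` for solenoidal
  tangential `u`, `{aᵢ}` an `L²`-orthonormal basis of the finite-dimensional space of harmonic
  fields; the kernels of the local problems (8) exist "by virtue of Theorem 5.1 of [8]"
  (= Solonnikov 1971), (9) p. 79, with `|∂ₓ^α g(x, y)| ≤ C|x − y|^{-1-|α|}` (10) for the
  second-order form of the problem;
* Solonnikov 1970/1971, the source of both: the Green matrices of Agmon–Douglis–Nirenberg
  problems are smooth off the diagonal up to the boundary, with estimates of their derivatives
  in both arguments (Ferrari (29) and Shirota–Yanagisawa (10) print the `x`-derivatives).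

`IsPeriodicCylinderGreenMatrix L G₁ G₂ C` renders the conjunction of those printed properties
which a derivation of (71) consumes, on the periodic cylinder `{r ≤ 1} × ℝ/Lℤ` of the Euler
programme with period cell `cylinderCell L = {r < 1} × (0, L)`: periodicity and `C¹`-regularity
of the kernels in the integration variable off the axial images of `x` up to the wall, the
size bounds `C|x − y|^{-2}`, the first `y`-derivative bounds `C|x − y|^{-3}` in the open
cylinder, and the representation `w(x) = ∫ G₁ curl w + ∫ (div w) G₂ + (πL)^{-1} (∫ w_z) e_z`
with Shirota–Yanagisawa's harmonic term, which in the periodic cylinder is the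
`L²(cell)`-orthogonal projection onto the unique harmonic field `e_z` (`‖e_z‖²_{L²(cell)} = πL`).

## Review record (D-0026) and status

This file first landed together with the named fact `Ferrari1993_periodicCylinderGreenMatrix`,
`∀ L > 0, ∃ G₁ G₂ C, IsPeriodicCylinderGreenMatrix L G₁ G₂ C`, minted as the second level of a
decomposition of `Ferrari1993_periodicCylinderVorticityH2LogEstimate` (level one being the
`δ`-family (71), `Ferrari1993_periodicCylinderVorticityH2DeltaLogEstimate`, from which that
target and the Shirota–Yanagisawa `δ`-family are proved in
`Ferrari1993Prop1DeltaFamily.lean`). The split review (with Ferrari pp. 283–293 and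
Shirota–Yanagisawa pp. 77–81 open) found: the fact is faithful to the sources, with the
adaptation caveat below, and is neither open nor misstated; but it is the elliptic theory
itself — Solonnikov's construction of the Green matrix of an Agmon–Douglis–Nirenberg system up
to a curved boundary with pointwise kernel estimates, for which Mathlib offers no elliptic
boundary regularity at all —, no file consumed it (the derivation of (71) from it had not
landed), and decompositions do not recurse. It was therefore **merged back** into the proof
obligation of the `δ`-family: the `def` is deleted and nothing else changes. The `δ`-family
(71) and its parent Prop. 1 have since been merged back as well by their own split reviews
(each equivalent to its parent or a strengthening of it: a `δ`-family and its logarithmic form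
imply each other by the choice of `δ` one way and by the scaling `v ↦ c v` the other, and
Prop. 1 is Cor. 1 with `‖curl v‖_{H²}` for `‖v‖_{H³}`; `Ferrari1993Prop1DeltaFamily.lean`,
`Ferrari1993Prop1LogEstimate.lean`, `PeriodicCylinderLogDivCurl.lean`), so that the chain
`ShirotaYanagisawa1993_periodicCylinderLogDivCurlEstimate → ShirotaYanagisawa1993_periodicCylinderLogEstimate
→ Ferrari1993_periodicCylinderH3Bound → Ferrari1993_periodicCylinderContinuation →
Ferrari1993_periodicCylinderEulerBKM` has the single potential-theoretic leaf
`ShirotaYanagisawa1993_periodicCylinderLogDivCurlEstimate` recorded in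
`Ferrari1993ContinuationLeaves.lean`. The predicate stays, as the hypothesis under which a
derivation of the `δ`-family (71) — and through
`ShirotaYanagisawa1993_periodicCylinderLogDivCurlEstimate_of_deltaLogEstimate`
(`Ferrari1993Prop1DeltaFamily.lean`) of that leaf — is to be written,
`theorem ShirotaYanagisawa1993_periodicCylinderLogDivCurlEstimate_of_greenMatrix
  (hG : ∀ L, 0 < L → ∃ G₁ G₂ C, IsPeriodicCylinderGreenMatrix L G₁ G₂ C) :
  ShirotaYanagisawa1993_periodicCylinderLogDivCurlEstimate`, a reduction which mints no fact.

## The derivation of (71) the predicate is cut for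

Both printed proofs use, besides the kernel bounds, the `W^{1,p}` / `W^{2,p}` a-priori
estimates of Agmon–Douglis–Nirenberg (Ferrari's Thm 3 p. 285 = Thm 10.5 of ADN II, in (47),
(62)–(63), (68) and on p. 293; Shirota–Yanagisawa (18), (22)–(23)) for the lower-order and
commutator terms of a localized problem, Ferrari noting that integrating by parts in the
representation "is impossible by the asymmetry of `𝒢_Ω`" (p. 287). In the periodic cylinder
this second elliptic input is avoidable, which is why the predicate carries Solonnikov's first
`y`-derivative bounds (`norm_fderiv_le₁`, `norm_fderiv_le₂`) and the representation of fields
that need not be solenoidal (`repr` with the `div` datum): (i) the admissible class (smooth on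
the closed cylinder, periodic, tangential) is invariant under the axial translations, the
rotations about the axis and — for fields cut off away from the wall by a radial `ζ` — the
horizontal translations, so that differentiating `repr` along these one-parameter families
represents `∂_z w`, `∂_θ w` and, near the axis, `∂_k (ζ w)` by the same kernels applied to the
derivative of the data (Shirota–Yanagisawa p. 80: each `∂Φ*w/∂ξᵢ`, `i = 1, 2`, "satisfies also
the same boundary conditions"); (ii) far field `|x − y| > δ`: integration by parts in `y` along
the same divergence-free fields, which are tangential to the wall and compatible with the
periodic ends (Gauss–Green on the cell, `PeriodicCylinderGaussGreen.lean`,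
`PeriodicCylinderWithinCalculus.lean`), then `∫_{cell, |x−y|>δ} |x − y|^{-3} dy ≤ C (1 + log(1/δ))`
(Ferrari (37)), the cell being moved into the window `|y₂ − x₂| ≤ L/2` by periodicity
(`PeriodicCylinderCellTranslates.lean`); (iii) near field:
`∫_{|x−y|<2δ} |x − y|^{-2} |Dφ| dy ≤ C δ^{1/2} ‖Dφ‖_{L⁶} ≤ C δ^{1/2} ‖φ‖_{H²(cell)}` (Ferrari
(48): Hölder with exponents `(6/5, 6)` and Sobolev's inequality on the cell,
`PeriodicCylinderSobolevInequalities.lean`); (iv) the sup bound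
`‖w‖_{L^∞} ≤ C (sup |curl w| + sup |div w| + ‖w‖_{L²(cell)})` directly from `repr` and
`norm_le₁`, `norm_le₂` (in place of Ferrari's use of (24) on p. 293); (v) near the wall the
radial derivative of a field is a linear combination of `∂_θ w / r`, `∂_z w`, `w / r`, `curl w`
and `div w` (Shirota–Yanagisawa p. 81, last paragraph). None of (i)–(v) is in this file.

## Faithfulness / what is NOT here

* The predicate asks for a SUBSET of the printed conclusions: fields `w` of class `C^∞` on the
  closed cylinder (the sources: `C^{1+α}`, resp. `H^s`), `L`-periodic in `z` and tangential on
  `{r = 1}`, *not* assumed divergence free (data `(curl w, div w)`, the instance `χ = 0` of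
  (22)); the representation at interior points `r(x) < 1`, with integrals over the open period
  cell; the kernels `L`-periodic in `y`, so that the bounds, stated in the window
  `|y₂ − x₂| ≤ L/2` where `|x − y|` is the distance on the quotient, determine them everywhere;
  regularity only in `y` and only to first order (`C¹` on the closed cylinder minus the axial
  images of `x`; derivative bounds at interior points), less than Solonnikov proves; size bounds
  with `|β| = 0` only.
* Adaptation caveat (as for every fact of this chain, `Ferrari1993_periodicCylinderH3Bound`):
  the sources treat bounded smooth domains of `ℝ³` (Ferrari: simply connected, where (22) is
  uniquely solvable by Lemma 4 p. 285 and no harmonic term occurs; Shirota–Yanagisawa: general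
  topology, harmonic projection `Σ (u, aᵢ) aᵢ`); the periodic cylinder `{r ≤ 1} × ℝ/Lℤ` is a
  compact flat manifold with smooth boundary, to which Solonnikov's construction (local
  parametrices, flattening of the boundary) applies verbatim, and whose harmonic fields (curl
  free, divergence free, tangential, periodic) are the multiples of `e_z` (`H¹(D × S¹) ≅ ℝ`),
  with `‖e_z‖²_{L²(cell)} = πL`; this is the use made of these results in the periodic cylinder
  by Luo–Hou 2014, §4.4 p. 1744.
* Not here: the existence statement `∃ G₁ G₂ C, IsPeriodicCylinderGreenMatrix L G₁ G₂ C` in any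
  form — neither as a theorem (a theory) nor, after the review, as a named fact — and any
  consequence of the predicate beyond its unfolding API (items (i)–(v) above).

Tree search: `lean search 'Green.*[Mm]atrix|Solonnikov|GreenPair'` — docstring mentions only
(`Ferrari1993Prop1LogEstimate`, `PeriodicCylinderLogDivCurl`, `PressureGreenEstimate` for the
scalar Neumann problem of the pressure); whole-space kernels of this type are the tree's
`IsC1SingularKernel` (`SingularKernelTruncation.lean`, translation invariant, no boundary).
-/

noncomputable section

open MeasureTheory Set Function Filter Topology TopologicalSpace
open scoped ContDiff NNReal ENNReal InnerProductSpace RealInnerProductSpace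

namespace Literature.Analysis.FluidPDE

/-- Local notation for physical space `ℝ³ = EuclideanSpace ℝ (Fin 3)`. -/
local notation "ℝ³" => EuclideanSpace ℝ (Fin 3)

/-- The axial images `x + kL e_z`, `k ∈ ℤ`, of a point `x` under the period lattice of the
periodic cylinder `{r ≤ 1} × ℝ/Lℤ`: the singular set, in the integration variable, of a kernel
which is `L`-periodic in that variable and singular on the diagonal. [folklore] -/
def axialImages (L : ℝ) (x : ℝ³) : Set ℝ³ :=
  range fun k : ℤ => x + ((k : ℝ) * L) • EuclideanSpace.single (2 : Fin 3) (1 : ℝ)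

/-- `x` is one of its own axial images (`k = 0`). [folklore] -/
theorem self_mem_axialImages (L : ℝ) (x : ℝ³) : x ∈ axialImages L x :=
  ⟨0, by simp⟩

/-- Membership in the set of axial images, unfolded. [folklore] -/
theorem mem_axialImages_iff {L : ℝ} {x y : ℝ³} :
    y ∈ axialImages L x ↔ ∃ k : ℤ, y = x + ((k : ℝ) * L) • EuclideanSpace.single (2 : Fin 3) (1 : ℝ) := by
  simp only [axialImages, mem_range, eq_comm]

/-- **Green matrix of the div–curl system with tangential boundary condition in the periodic
cylinder** — the predicate (hypothesis form; its status is recorded in the module docstring).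
`IsPeriodicCylinderGreenMatrix L G₁ G₂ C` says that the kernels `G₁(x, y) ∈ L(ℝ³, ℝ³)`
(response of the velocity to the curl) and `G₂(x, y) ∈ ℝ³` (response to the divergence) with
the constant `C` have the properties printed for the velocity blocks of Solonnikov's Green
matrix `𝒢_Ω` of the system (22) of Ferrari 1993 (Thm 4 (28)–(29) p. 285, "a specialization of
Theorem 1.1 of [11]" = Solonnikov 1970, used as (33)–(34) p. 286 for the solution `v = (u, 0)`
with interior datum `φ = (curl u, div u)` and boundary datum `χ = 0`) and for the kernels of
the decomposition (5) / generalized Biot–Savart law (6) of Shirota–Yanagisawa 1993 (p. 78; the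
kernels (9) p. 79 "by virtue of Theorem 5.1 of [8]" = Solonnikov 1971, with the bounds (10)),
read on the periodic cylinder `{r ≤ 1} × ℝ/Lℤ` with period cell `cylinderCell L = {r < 1} × (0, L)`:
* `periodic₁`, `periodic₂`: `L`-periodicity in `y` (kernels live on the quotient);
* `contDiffOn₁`, `contDiffOn₂`: for `r(x) < 1`, `y ↦ Gᵢ(x, y)` is `C¹` on the closed cylinder
  `{r ≤ 1}` minus the axial images of `x` (Solonnikov: smooth off the diagonal up to the
  boundary);
* `norm_le₁`, `norm_le₂`: `‖Gᵢ(x, y)‖ ≤ C |x − y|^{-2}` for `r(x) < 1`, `r(y) ≤ 1`, `y ≠ x`,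
  `|y₂ − x₂| ≤ L/2` (Ferrari (29) = (34) with `|β| = 0`; in that window `|x − y|` is the
  distance on the quotient);
* `norm_fderiv_le₁`, `norm_fderiv_le₂`: `‖D_y Gᵢ(x, y)‖ ≤ C |x − y|^{-3}` for `r(x), r(y) < 1`,
  `y ≠ x`, `|y₂ − x₂| ≤ L/2` (Solonnikov 1970/71, first derivatives in the second argument;
  Ferrari (29), Shirota–Yanagisawa (10) print the `x`-derivatives);
* `repr`: for every `w` of class `C^∞` on the closed cylinder, `L`-periodic in `z` and
  tangential on the wall (`⟪w, e_r⟫ = 0` on `{r = 1}`), and every `x` with `r(x) < 1`,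
  `w(x) = ∫_cell G₁(x,y) curl w(y) dy + ∫_cell div w(y) G₂(x,y) dy + (πL)^{-1} (∫_cell w_z) e_z`
  (Ferrari (28) = (33) for the solution `(w, 0)` of (22) with data `(curl w, div w)`, plus the
  `L²(cell)`-orthogonal projection onto the harmonic fields of Shirota–Yanagisawa's
  decomposition (5)–(6), which on the periodic cylinder are the multiples of `e_z`,
  `‖e_z‖²_{L²(cell)} = πL`).
Adaptation caveat: printed for bounded smooth domains of `ℝ³`; the periodic cylinder is a
compact flat manifold with boundary (see the module docstring). [cite: Ferrari1993, Thm 4 (28)–(29) p. 285; (33)–(34) p. 286; system (21)–(22) pp. 283–284]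
[cite: ShirotaYanagisawa1993, (5)–(6) p. 78 and (9)–(10) p. 79]
[cite: Solonnikov1971, Thm 5.1 as cited by Shirota–Yanagisawa 1993 for (9); with part I (Solonnikov 1970), Thm 1.1 as cited by Ferrari 1993, Thm 4] -/
structure IsPeriodicCylinderGreenMatrix (L : ℝ) (G₁ : ℝ³ → ℝ³ → (ℝ³ →L[ℝ] ℝ³))
    (G₂ : ℝ³ → ℝ³ → ℝ³) (C : ℝ) : Prop where
  nonneg : 0 ≤ C
  periodic₁ : ∀ x, IsAxiallyPeriodic L (G₁ x)
  periodic₂ : ∀ x, IsAxiallyPeriodic L (G₂ x)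
  contDiffOn₁ : ∀ x ∈ (unitCylinder : Set ℝ³),
    ContDiffOn ℝ 1 (G₁ x) (closure (unitCylinder : Set ℝ³) \ axialImages L x)
  contDiffOn₂ : ∀ x ∈ (unitCylinder : Set ℝ³),
    ContDiffOn ℝ 1 (G₂ x) (closure (unitCylinder : Set ℝ³) \ axialImages L x)
  norm_le₁ : ∀ x ∈ (unitCylinder : Set ℝ³), ∀ y ∈ closure (unitCylinder : Set ℝ³), y ≠ x →
    |y 2 - x 2| ≤ L / 2 → ‖G₁ x y‖ ≤ C * (‖x - y‖ ^ 2)⁻¹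
  norm_le₂ : ∀ x ∈ (unitCylinder : Set ℝ³), ∀ y ∈ closure (unitCylinder : Set ℝ³), y ≠ x →
    |y 2 - x 2| ≤ L / 2 → ‖G₂ x y‖ ≤ C * (‖x - y‖ ^ 2)⁻¹
  norm_fderiv_le₁ : ∀ x ∈ (unitCylinder : Set ℝ³), ∀ y ∈ (unitCylinder : Set ℝ³), y ≠ x →
    |y 2 - x 2| ≤ L / 2 → ‖fderiv ℝ (G₁ x) y‖ ≤ C * (‖x - y‖ ^ 3)⁻¹
  norm_fderiv_le₂ : ∀ x ∈ (unitCylinder : Set ℝ³), ∀ y ∈ (unitCylinder : Set ℝ³), y ≠ x →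
    |y 2 - x 2| ≤ L / 2 → ‖fderiv ℝ (G₂ x) y‖ ≤ C * (‖x - y‖ ^ 3)⁻¹
  repr : ∀ (w : ℝ³ → ℝ³), ContDiffOn ℝ ∞ w (closure (unitCylinder : Set ℝ³)) →
    IsAxiallyPeriodic L w → (∀ y ∈ frontier (unitCylinder : Set ℝ³), ⟪w y, eR y⟫ = 0) →
    ∀ x ∈ (unitCylinder : Set ℝ³),
      w x = (∫ y in (cylinderCell L : Set ℝ³), G₁ x y (curl w y)) +
        (∫ y in (cylinderCell L : Set ℝ³), (VectorCalculus.divergence w y) • G₂ x y) +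
        ((Real.pi * L)⁻¹ * ∫ y in (cylinderCell L : Set ℝ³), w y 2) •
          EuclideanSpace.single (2 : Fin 3) (1 : ℝ)

namespace IsPeriodicCylinderGreenMatrix

variable {L : ℝ} {G₁ : ℝ³ → ℝ³ → (ℝ³ →L[ℝ] ℝ³)} {G₂ : ℝ³ → ℝ³ → ℝ³} {C : ℝ}

/-- In the window `|y₂ − x₂| ≤ L/2` a point `y ≠ x` of the closed cylinder is not an axial image
of `x` (the other images are at axial distance `≥ L`), so the kernel is `C¹` near it within the
closed cylinder. [folklore] -/
theorem not_mem_axialImages_of_window (hL : 0 < L) {x y : ℝ³} (hyx : y ≠ x)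
    (hw : |y 2 - x 2| ≤ L / 2) : y ∉ axialImages L x := by
  rintro ⟨k, rfl⟩
  have h2 : (x + ((k : ℝ) * L) • EuclideanSpace.single (2 : Fin 3) (1 : ℝ)) 2 - x 2 = k * L := by
    simp
  rw [h2] at hw
  rcases eq_or_ne k 0 with hk | hk
  · apply hyx
    simp [hk]
  · have hk1 : (1 : ℝ) ≤ |(k : ℝ)| := by
      rw [← Int.cast_abs]
      exact_mod_cast Int.one_le_abs hk
    have : L ≤ |(k : ℝ) * L| := by
      rw [abs_mul, abs_of_pos hL]
      nlinarith
    linarith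

/-- Two distinct axial images of a point are at distance at least `L`. [folklore] -/
theorem pairwise_le_dist_axialImages (hL : 0 < L) (x : ℝ³) :
    (axialImages L x).Pairwise fun a b => L ≤ dist a b := by
  rintro a ⟨m, rfl⟩ b ⟨n, rfl⟩ hab
  have hmn : m ≠ n := fun h => hab (by rw [h])
  have h1 : (1 : ℝ) ≤ |((m : ℝ) - n)| := by
    rw [← Int.cast_sub, ← Int.cast_abs]
    exact_mod_cast Int.one_le_abs (sub_ne_zero.2 hmn)
  have hn : ‖EuclideanSpace.single (2 : Fin 3) (1 : ℝ)‖ = 1 := by simp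
  rw [dist_eq_norm, add_sub_add_left_eq_sub, ← sub_smul, norm_smul, ← sub_mul,
    hn, mul_one, Real.norm_eq_abs, abs_mul, abs_of_pos hL]
  nlinarith

/-- The set of axial images is closed (a uniformly discrete set). [folklore] -/
theorem isClosed_axialImages (hL : 0 < L) (x : ℝ³) : IsClosed (axialImages L x) :=
  Metric.isClosed_of_pairwise_le_dist hL (pairwise_le_dist_axialImages hL x)

/-- In the window, the punctured closed cylinder `{r ≤ 1} ∖ images(x)` is a neighbourhood of every
interior point `y ≠ x`. [folklore] -/
theorem closure_diff_axialImages_mem_nhds (hL : 0 < L) {x y : ℝ³}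
    (hy : y ∈ (unitCylinder : Set ℝ³)) (hyx : y ≠ x) (hw : |y 2 - x 2| ≤ L / 2) :
    closure (unitCylinder : Set ℝ³) \ axialImages L x ∈ 𝓝 y :=
  Filter.inter_mem (mem_of_superset (unitCylinder.isOpen.mem_nhds hy) subset_closure)
    ((isClosed_axialImages hL x).isOpen_compl.mem_nhds (not_mem_axialImages_of_window hL hyx hw))

/-- The kernel `y ↦ G₁(x, y)` is differentiable at every interior point `y ≠ x` of the window,
so that `fderiv ℝ (G₁ x) y` in `norm_fderiv_le₁` is its derivative. [folklore] -/
theorem differentiableAt₁ (hG : IsPeriodicCylinderGreenMatrix L G₁ G₂ C) (hL : 0 < L) {x y : ℝ³}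
    (hx : x ∈ (unitCylinder : Set ℝ³)) (hy : y ∈ (unitCylinder : Set ℝ³)) (hyx : y ≠ x)
    (hw : |y 2 - x 2| ≤ L / 2) : DifferentiableAt ℝ (G₁ x) y :=
  ((hG.contDiffOn₁ x hx).differentiableOn one_ne_zero y
    ⟨subset_closure hy, not_mem_axialImages_of_window hL hyx hw⟩).differentiableAt
    (closure_diff_axialImages_mem_nhds hL hy hyx hw)

/-- The same for `G₂`. [folklore] -/
theorem differentiableAt₂ (hG : IsPeriodicCylinderGreenMatrix L G₁ G₂ C) (hL : 0 < L) {x y : ℝ³}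
    (hx : x ∈ (unitCylinder : Set ℝ³)) (hy : y ∈ (unitCylinder : Set ℝ³)) (hyx : y ≠ x)
    (hw : |y 2 - x 2| ≤ L / 2) : DifferentiableAt ℝ (G₂ x) y :=
  ((hG.contDiffOn₂ x hx).differentiableOn one_ne_zero y
    ⟨subset_closure hy, not_mem_axialImages_of_window hL hyx hw⟩).differentiableAt
    (closure_diff_axialImages_mem_nhds hL hy hyx hw)

end IsPeriodicCylinderGreenMatrix

end Literature.Analysis.FluidPDE
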